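import Mathlib.Analysis.Calculus.MeanValue
import Mathlib.Analysis.Calculus.Deriv.Pow
import Mathlib.Analysis.Calculus.Deriv.Inv
import Literature.Probability.LatticeModels.RandomClusterFiniteVolumePressure
import HarnessLib

/-!
# Russo's formula for tilted measures (Grimmett 2006, Thm. (2.43)) and the boundary-condition-uniform
# Lipschitz bound in `p` for finite-volume random-cluster probabilities

Support file of the `fk-continuity` cell (FANOUT-PLAN.md row FO-09, `--supports stmt-CriticalPhenomena-4575`);
builds on p205010 (kernel theorem, internal audit signed; external expert review pending).

Grimmett 2006, §2.4, eq. (2.42): for a finite weight `μ` on `Ω = {0,1}^E` and `p ∈ (0, 1)` let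
`μ_p(ω) = Z_p⁻¹ μ(ω) ∏_e p^{ω(e)} (1-p)^{1-ω(e)}`.  **Theorem (2.43)** [eq. (2.44)]: for every random variable `X`,
`d/dp μ_p(X) = cov_p(|η|, X) / (p(1-p))`, `η` the set of open edges.  The finite-volume random-cluster measure
`φ^B_{G,p,q}` of the tree (`rcMeasure G p q B`, any wired set `B`, any `q > 0`) is the case `μ(ω) = q^{k^B(ω)}`.
Since `|cov_p(|η|, 1_A)| ≤ |E|`, the derivative of `p ↦ φ^B_{G,p,q}(A)` is bounded by `|E(G)| / (p(1-p))`
UNIFORMLY in the boundary condition `B`, in `q` and in the event `A`, whence the Lipschitz bound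
`|φ^B_{G,p',q}(A) - φ^B_{G,p,q}(A)| ≤ |E(G)| · |p' - p| / min {p(1-p), p'(1-p')}` (the minimum of the concave
function `r ↦ r(1-r)` over the segment `[p, p']` is attained at an end point).  This is the `q ≥ 1` replacement
of the tree's Bernoulli statement `SameP.abs_real_sub_real_le` (`|P_{p'}(A) - P_p(A)| ≤ 2|F| |p' - p|`) needed
by the FK continuation principle (cell row FO-11): under `φ` the probability of an event depends on `p` through
every edge of the region, so the constant is the number of edges of the REGION, not of the event's support, and
it degenerates at `p ∈ {0, 1}`.

## Contents (all proved; no named facts)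

* generic finite weighted averages `E_w[X] = (Σ_ω w(ω) X(ω)) / Σ_ω w(ω)` on a `Finset`:
  `hasDerivAt_sum_mul_div_sum` (quotient rule in covariance form, GRC (2.47)), `cov_eq_mul_cov_of_affine`,
  `abs_cov_le_sub` (`|cov_w(ℓ, X)| ≤ sup ℓ - inf ℓ` for `0 ≤ X ≤ 1`);
* the tilted family `w_r(ω) = r^{a(ω)} (1-r)^{b(ω)} μ(ω)` (`a, b ≤ N`): `hasDerivAt_pow_mul_one_sub_pow_mul`
  (log-derivative `a/r - b/(1-r)`), `sum_tilt_pos`, and the abstract Lipschitz bound `abs_tiltAvg_sub_tiltAvg_le`;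
* random-cluster instances: `rcExpect_eq_sum_mul_div` (the tree's `rcExpect` is such an average),
  `hasDerivAt_rcExpect` and `hasDerivAt_rcMeasure_real` (**Thm. (2.43) / eq. (2.44)** for `φ^B_{G,p,q}`),
  `abs_rcMeasure_real_sub_le` (the b.c.-uniform Lipschitz bound) and `abs_rcMeasure_real_sub_le_of_mem_Icc`
  (constant `|E(G)| / (δ(1-δ))` on `[δ, 1-δ]`).

## References

* G. Grimmett, *The Random-Cluster Model*, Springer 2006, §2.4: eq. (2.42), Thm. (2.43) with eq. (2.44)–(2.47), p. 40;
  §1.2 eq. (1.2) (the random-cluster measure). [Grimmett2006]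
* G. Grimmett, *Percolation*, 2nd ed., Springer 1999, §2.4 (Russo's formula). [GrimmettPercolation1999]
-/

noncomputable section

namespace Summit.CriticalPhenomena.PercolationContinuityZ3.Theorems

namespace FK

open MeasureTheory Finset Literature.Probability.LatticeModels Literature.Probability.Percolation
open scoped Topology

/-! ### Finite weighted averages: the quotient rule in covariance form, and a covariance bound -/

section WeightedAverage

variable {Ω : Type*}

/-- **Quotient rule in covariance form** (Grimmett 2006, proof of Thm. (2.43), eq. (2.47)): if each weight
`r ↦ w_r(ω)` has derivative `w_p(ω) ℓ(ω)` at `r = p` (`ℓ` = logarithmic derivative) and `Z_p = Σ_ω w_p(ω) ≠ 0`, then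
`r ↦ E_{w_r}[X] = (Σ_ω w_r(ω) X(ω)) / Z_r` has derivative `E_p[ℓ X] - E_p[ℓ] E_p[X] = cov_p(ℓ, X)` at `p`.
[cite: Grimmett2006, proof of Thm. (2.43), eq. (2.47) p. 40] -/
theorem hasDerivAt_sum_mul_div_sum (s : Finset Ω) {w : ℝ → Ω → ℝ} {ℓ : Ω → ℝ} {p : ℝ} (X : Ω → ℝ)
    (hw : ∀ ω ∈ s, HasDerivAt (fun r => w r ω) (w p ω * ℓ ω) p) (hZ : ∑ ω ∈ s, w p ω ≠ 0) :
    HasDerivAt (fun r => (∑ ω ∈ s, w r ω * X ω) / ∑ ω ∈ s, w r ω)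
      ((∑ ω ∈ s, w p ω * (ℓ ω * X ω)) / (∑ ω ∈ s, w p ω) -
        (∑ ω ∈ s, w p ω * ℓ ω) / (∑ ω ∈ s, w p ω) * ((∑ ω ∈ s, w p ω * X ω) / ∑ ω ∈ s, w p ω)) p := by
  have hnum : HasDerivAt (fun r => ∑ ω ∈ s, w r ω * X ω) (∑ ω ∈ s, w p ω * ℓ ω * X ω) p :=
    HasDerivAt.fun_sum fun ω hω => (hw ω hω).mul_const (X ω)
  have hden : HasDerivAt (fun r => ∑ ω ∈ s, w r ω) (∑ ω ∈ s, w p ω * ℓ ω) p :=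
    HasDerivAt.fun_sum fun ω hω => hw ω hω
  refine (hnum.fun_div hden hZ).congr_deriv ?_
  simp only [mul_assoc]
  field_simp

/-- Covariances `cov_w(ℓ, X) = E_w[ℓ X] - E_w[ℓ] E_w[X]` of finite weighted averages transform linearly under an
affine change `ℓ' = c₁ ℓ + c₂` of the first argument: `cov_w(ℓ', X) = c₁ cov_w(ℓ, X)`. [folklore] -/
theorem cov_eq_mul_cov_of_affine (s : Finset Ω) {w ℓ ℓ' : Ω → ℝ} (X : Ω → ℝ) {c₁ c₂ : ℝ}
    (hZ : ∑ ω ∈ s, w ω ≠ 0) (h : ∀ ω ∈ s, ℓ' ω = c₁ * ℓ ω + c₂) :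
    (∑ ω ∈ s, w ω * (ℓ' ω * X ω)) / (∑ ω ∈ s, w ω) -
        (∑ ω ∈ s, w ω * ℓ' ω) / (∑ ω ∈ s, w ω) * ((∑ ω ∈ s, w ω * X ω) / ∑ ω ∈ s, w ω) =
      c₁ * ((∑ ω ∈ s, w ω * (ℓ ω * X ω)) / (∑ ω ∈ s, w ω) -
        (∑ ω ∈ s, w ω * ℓ ω) / (∑ ω ∈ s, w ω) * ((∑ ω ∈ s, w ω * X ω) / ∑ ω ∈ s, w ω)) := by
  have e1 : ∑ ω ∈ s, w ω * (ℓ' ω * X ω) =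
      c₁ * ∑ ω ∈ s, w ω * (ℓ ω * X ω) + c₂ * ∑ ω ∈ s, w ω * X ω := by
    rw [Finset.mul_sum, Finset.mul_sum, ← Finset.sum_add_distrib]
    exact Finset.sum_congr rfl fun ω hω => by rw [h ω hω]; ring
  have e2 : ∑ ω ∈ s, w ω * ℓ' ω = c₁ * ∑ ω ∈ s, w ω * ℓ ω + c₂ * ∑ ω ∈ s, w ω := by
    rw [Finset.mul_sum, Finset.mul_sum, ← Finset.sum_add_distrib]
    exact Finset.sum_congr rfl fun ω hω => by rw [h ω hω]; ring
  rw [e1, e2]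
  field_simp
  ring

/-- **Covariance bound.** For nonnegative weights with positive total mass, `ℓ` with values in `[lo, hi]` and `X`
with values in `[0, 1]`: `|E_w[ℓ X] - E_w[ℓ] E_w[X]| ≤ hi - lo` (both `E_w[(ℓ - lo) X]` and `E_w[ℓ - lo] E_w[X]`
lie in `[0, hi - lo]`). [folklore] -/
theorem abs_cov_le_sub (s : Finset Ω) {w ℓ X : Ω → ℝ} {lo hi : ℝ} (hw : ∀ ω ∈ s, 0 ≤ w ω)
    (hZ : 0 < ∑ ω ∈ s, w ω) (hℓ : ∀ ω ∈ s, lo ≤ ℓ ω ∧ ℓ ω ≤ hi) (hX : ∀ ω ∈ s, 0 ≤ X ω ∧ X ω ≤ 1) :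
    |(∑ ω ∈ s, w ω * (ℓ ω * X ω)) / (∑ ω ∈ s, w ω) -
        (∑ ω ∈ s, w ω * ℓ ω) / (∑ ω ∈ s, w ω) * ((∑ ω ∈ s, w ω * X ω) / ∑ ω ∈ s, w ω)| ≤ hi - lo := by
  have hZ0 : ∑ ω ∈ s, w ω ≠ 0 := hZ.ne'
  -- replace `ℓ` by `ℓ - lo ≥ 0`
  rw [cov_eq_mul_cov_of_affine s (ℓ := fun ω => ℓ ω - lo) X (c₁ := 1) (c₂ := lo) hZ0 (fun ω _ => by ring), one_mul]
  set Z := ∑ ω ∈ s, w ω with hZdef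
  have hC0 : 0 ≤ (∑ ω ∈ s, w ω * X ω) / Z :=
    div_nonneg (Finset.sum_nonneg fun ω hω => mul_nonneg (hw ω hω) (hX ω hω).1) hZ.le
  have hC1 : (∑ ω ∈ s, w ω * X ω) / Z ≤ 1 := by
    rw [div_le_one hZ, hZdef]
    exact Finset.sum_le_sum fun ω hω => mul_le_of_le_one_right (hw ω hω) (hX ω hω).2
  have hx0 : 0 ≤ (∑ ω ∈ s, w ω * ((ℓ ω - lo) * X ω)) / Z :=
    div_nonneg (Finset.sum_nonneg fun ω hω =>
      mul_nonneg (hw ω hω) (mul_nonneg (sub_nonneg.2 (hℓ ω hω).1) (hX ω hω).1)) hZ.le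
  have hx1 : (∑ ω ∈ s, w ω * ((ℓ ω - lo) * X ω)) / Z ≤ hi - lo := by
    rw [div_le_iff₀ hZ, hZdef, Finset.mul_sum]
    refine Finset.sum_le_sum fun ω hω => ?_
    have h1 : (ℓ ω - lo) * X ω ≤ hi - lo :=
      (mul_le_of_le_one_right (sub_nonneg.2 (hℓ ω hω).1) (hX ω hω).2).trans (sub_le_sub_right (hℓ ω hω).2 lo)
    calc w ω * ((ℓ ω - lo) * X ω) ≤ w ω * (hi - lo) := mul_le_mul_of_nonneg_left h1 (hw ω hω)
      _ = (hi - lo) * w ω := mul_comm _ _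
  have hy0 : 0 ≤ (∑ ω ∈ s, w ω * (ℓ ω - lo)) / Z :=
    div_nonneg (Finset.sum_nonneg fun ω hω => mul_nonneg (hw ω hω) (sub_nonneg.2 (hℓ ω hω).1)) hZ.le
  have hy1 : (∑ ω ∈ s, w ω * (ℓ ω - lo)) / Z ≤ hi - lo := by
    rw [div_le_iff₀ hZ, hZdef, Finset.mul_sum]
    refine Finset.sum_le_sum fun ω hω => ?_
    calc w ω * (ℓ ω - lo) ≤ w ω * (hi - lo) :=
          mul_le_mul_of_nonneg_left (sub_le_sub_right (hℓ ω hω).2 lo) (hw ω hω)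
      _ = (hi - lo) * w ω := mul_comm _ _
  rw [abs_le]
  constructor
  · nlinarith [mul_le_mul hy1 hC1 hC0 (hx0.trans hx1)]
  · nlinarith [mul_nonneg hy0 hC0]

end WeightedAverage

/-! ### The tilted family `w_r(ω) = r^{a(ω)} (1-r)^{b(ω)} μ(ω)` (Grimmett 2006, eq. (2.42)/(2.46)) -/

section Tilt

variable {Ω : Type*}

/-- `n x^{n-1} = x^n · (n/x)` for `x ≠ 0` (with `ℕ`-subtraction in the exponent, both sides vanish at `n = 0`).
[folklore] -/
theorem natCast_mul_pow_sub_one {x : ℝ} (hx : x ≠ 0) (n : ℕ) : (n : ℝ) * x ^ (n - 1) = x ^ n * (n / x) := by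
  cases n with
  | zero => simp
  | succ k =>
    simp only [Nat.add_sub_cancel, Nat.cast_succ]
    field_simp
    ring

/-- The logarithmic derivative of the tilted weight `r ↦ r^a (1-r)^b μ` (Grimmett 2006, eq. (2.46)–(2.47):
`ν_p(ω) = p^{|η(ω)|} (1-p)^{N-|η(ω)|} μ(ω)`, `dν_p/dp = (|η|/p - (N-|η|)/(1-p)) ν_p`) at `p ∉ {0, 1}`.
[cite: Grimmett2006, proof of Thm. (2.43), eq. (2.46)–(2.47) p. 40] -/
theorem hasDerivAt_pow_mul_one_sub_pow_mul (a b : ℕ) (μ : ℝ) {p : ℝ} (hp0 : p ≠ 0) (hp1 : p ≠ 1) :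
    HasDerivAt (fun r : ℝ => r ^ a * (1 - r) ^ b * μ) (p ^ a * (1 - p) ^ b * μ * (a / p - b / (1 - p))) p := by
  have hq : (1 - p) ≠ 0 := sub_ne_zero.2 (Ne.symm hp1)
  have h1 : HasDerivAt (fun r : ℝ => r ^ a) ((a : ℝ) * p ^ (a - 1)) p := hasDerivAt_pow a p
  have h2 : HasDerivAt (fun r : ℝ => (1 - r) ^ b) ((b : ℝ) * (1 - p) ^ (b - 1) * -1) p :=
    ((hasDerivAt_id' p).const_sub 1).fun_pow b
  refine ((h1.fun_mul h2).mul_const μ).congr_deriv ?_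
  rw [natCast_mul_pow_sub_one hp0, natCast_mul_pow_sub_one hq]
  ring

/-- The normalising constant `Z_r = Σ_ω r^{a(ω)} (1-r)^{b(ω)} μ(ω)` of the tilted family is positive for `r ∈ (0,1)`
as soon as `μ ≥ 0` has a positive entry (Grimmett 2006, eq. (2.42): "`μ_p` is strictly positive iff `μ` is").
[cite: Grimmett2006, §2.4 eq. (2.42) p. 40] -/
theorem sum_tilt_pos (s : Finset Ω) (a b : Ω → ℕ) {μ : Ω → ℝ} (hμ : ∀ ω ∈ s, 0 ≤ μ ω)
    (hμ0 : ∃ ω ∈ s, 0 < μ ω) {r : ℝ} (hr : r ∈ Set.Ioo (0 : ℝ) 1) :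
    0 < ∑ ω ∈ s, r ^ a ω * (1 - r) ^ b ω * μ ω := by
  obtain ⟨ω₀, hω₀, hμω₀⟩ := hμ0
  have h1 : 0 < 1 - r := sub_pos.2 hr.2
  exact Finset.sum_pos'
    (fun ω hω => mul_nonneg (mul_nonneg (pow_nonneg hr.1.le _) (pow_nonneg h1.le _)) (hμ ω hω))
    ⟨ω₀, hω₀, mul_pos (mul_pos (pow_pos hr.1 _) (pow_pos h1 _)) hμω₀⟩

/-- On `[p₁, p₂] ⊆ (0, 1)` (in either order) the concave function `r ↦ r(1-r)` is bounded below by its value at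
an end point. [folklore] -/
theorem min_mul_one_sub_le {p p' r : ℝ} (hr : r ∈ Set.uIcc p p') :
    min (p * (1 - p)) (p' * (1 - p')) ≤ r * (1 - r) := by
  rcases Set.mem_uIcc.1 hr with ⟨h1, h2⟩ | ⟨h1, h2⟩
  · by_cases h : 0 ≤ 1 - r - p
    · exact (min_le_left _ _).trans (by nlinarith)
    · exact (min_le_right _ _).trans (by nlinarith)
  · by_cases h : 0 ≤ 1 - r - p'
    · exact (min_le_right _ _).trans (by nlinarith)
    · exact (min_le_left _ _).trans (by nlinarith)

/-- **Russo's formula for tilted measures ⇒ a uniform Lipschitz bound** (Grimmett 2006, Thm. (2.43) and its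
consequence by the mean value theorem).  For the tilted family `w_r(ω) = r^{a(ω)} (1-r)^{b(ω)} μ(ω)` on a finite
set `s` with `a, b ≤ N`, `μ ≥ 0` not identically zero, and any `X` with values in `[0, 1]`: the averages
`E_r[X] = (Σ w_r X) / Σ w_r` satisfy `|E_{p'}[X] - E_p[X]| ≤ N / min{p(1-p), p'(1-p')} · |p' - p|` for
`p, p' ∈ (0, 1)` — the derivative is `cov_r(a/r - b/(1-r), X)` and `a/r - b/(1-r) ∈ [-N/(1-r), N/r]`, an interval
of length `N/(r(1-r))`.  Uniform in `μ` (hence in any boundary condition or conditioning encoded in `μ`).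
[cite: Grimmett2006, Thm. (2.43) eq. (2.44) p. 40] -/
theorem abs_tiltAvg_sub_tiltAvg_le (s : Finset Ω) {a b : Ω → ℕ} {μ : Ω → ℝ} {N : ℕ} (X : Ω → ℝ)
    (ha : ∀ ω ∈ s, a ω ≤ N) (hb : ∀ ω ∈ s, b ω ≤ N) (hμ : ∀ ω ∈ s, 0 ≤ μ ω) (hμ0 : ∃ ω ∈ s, 0 < μ ω)
    (hX : ∀ ω ∈ s, 0 ≤ X ω ∧ X ω ≤ 1) {p p' : ℝ} (hp : p ∈ Set.Ioo (0 : ℝ) 1) (hp' : p' ∈ Set.Ioo (0 : ℝ) 1) :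
    |(∑ ω ∈ s, p' ^ a ω * (1 - p') ^ b ω * μ ω * X ω) / (∑ ω ∈ s, p' ^ a ω * (1 - p') ^ b ω * μ ω) -
        (∑ ω ∈ s, p ^ a ω * (1 - p) ^ b ω * μ ω * X ω) / (∑ ω ∈ s, p ^ a ω * (1 - p) ^ b ω * μ ω)| ≤
      N / min (p * (1 - p)) (p' * (1 - p')) * |p' - p| := by
  set m := min (p * (1 - p)) (p' * (1 - p')) with hm
  have hm0 : 0 < m := lt_min (mul_pos hp.1 (sub_pos.2 hp.2)) (mul_pos hp'.1 (sub_pos.2 hp'.2))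
  -- the segment `[p, p']` lies inside `(0, 1)`
  have hseg : ∀ r ∈ Set.uIcc p p', r ∈ Set.Ioo (0 : ℝ) 1 := by
    intro r hr
    rcases Set.mem_uIcc.1 hr with ⟨h1, h2⟩ | ⟨h1, h2⟩
    · exact ⟨hp.1.trans_le h1, h2.trans_lt hp'.2⟩
    · exact ⟨hp'.1.trans_le h1, h2.trans_lt hp.2⟩
  -- the function, its derivative (covariance form) and the derivative bound on the segment
  set f : ℝ → ℝ := fun r => (∑ ω ∈ s, r ^ a ω * (1 - r) ^ b ω * μ ω * X ω) /
    ∑ ω ∈ s, r ^ a ω * (1 - r) ^ b ω * μ ω with hf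
  set w : ℝ → Ω → ℝ := fun r ω => r ^ a ω * (1 - r) ^ b ω * μ ω with hw
  set ℓ : ℝ → Ω → ℝ := fun r ω => (a ω : ℝ) / r - (b ω : ℝ) / (1 - r) with hℓ
  set f' : ℝ → ℝ := fun r => (∑ ω ∈ s, w r ω * (ℓ r ω * X ω)) / (∑ ω ∈ s, w r ω) -
    (∑ ω ∈ s, w r ω * ℓ r ω) / (∑ ω ∈ s, w r ω) * ((∑ ω ∈ s, w r ω * X ω) / ∑ ω ∈ s, w r ω) with hf'
  have hderiv : ∀ r ∈ Set.uIcc p p', HasDerivWithinAt f (f' r) (Set.uIcc p p') r := by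
    intro r hr
    have hr' := hseg r hr
    have hZ : ∑ ω ∈ s, w r ω ≠ 0 := (sum_tilt_pos s a b hμ hμ0 hr').ne'
    exact (hasDerivAt_sum_mul_div_sum s (w := w) (ℓ := ℓ r) X
      (fun ω _ => hasDerivAt_pow_mul_one_sub_pow_mul (a ω) (b ω) (μ ω) hr'.1.ne' hr'.2.ne) hZ).hasDerivWithinAt
  have hbound : ∀ r ∈ Set.uIcc p p', ‖f' r‖ ≤ N / m := by
    intro r hr
    have hr' := hseg r hr
    have h1r : 0 < 1 - r := sub_pos.2 hr'.2
    have hZ : 0 < ∑ ω ∈ s, w r ω := sum_tilt_pos s a b hμ hμ0 hr'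
    have hwnn : ∀ ω ∈ s, 0 ≤ w r ω := fun ω hω =>
      mul_nonneg (mul_nonneg (pow_nonneg hr'.1.le _) (pow_nonneg h1r.le _)) (hμ ω hω)
    have hℓr : ∀ ω ∈ s, -((N : ℝ) / (1 - r)) ≤ ℓ r ω ∧ ℓ r ω ≤ (N : ℝ) / r := by
      intro ω hω
      have haω : (a ω : ℝ) ≤ N := by exact_mod_cast ha ω hω
      have hbω : (b ω : ℝ) ≤ N := by exact_mod_cast hb ω hω
      have h0a : (0 : ℝ) ≤ a ω / r := div_nonneg (Nat.cast_nonneg _) hr'.1.le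
      have h0b : (0 : ℝ) ≤ b ω / (1 - r) := div_nonneg (Nat.cast_nonneg _) h1r.le
      constructor
      · have : (b ω : ℝ) / (1 - r) ≤ N / (1 - r) := div_le_div_of_nonneg_right hbω h1r.le
        show -((N : ℝ) / (1 - r)) ≤ (a ω : ℝ) / r - (b ω : ℝ) / (1 - r)
        linarith
      · have : (a ω : ℝ) / r ≤ N / r := div_le_div_of_nonneg_right haω hr'.1.le
        show (a ω : ℝ) / r - (b ω : ℝ) / (1 - r) ≤ N / r
        linarith
    have key := abs_cov_le_sub s hwnn hZ hℓr hX
    rw [Real.norm_eq_abs]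
    refine key.trans ?_
    have hr0 : r ≠ 0 := hr'.1.ne'
    have h1r0 : (1 : ℝ) - r ≠ 0 := h1r.ne'
    have hlen : (N : ℝ) / r - -((N : ℝ) / (1 - r)) = N / (r * (1 - r)) := by
      field_simp
      ring
    rw [hlen]
    exact div_le_div_of_nonneg_left (Nat.cast_nonneg N) hm0 (min_mul_one_sub_le hr)
  have := (convex_uIcc p p').norm_image_sub_le_of_norm_hasDerivWithin_le hderiv hbound
    Set.left_mem_uIcc Set.right_mem_uIcc
  simpa only [Real.norm_eq_abs, hf] using this

end Tilt

/-! ### Random-cluster instances: Grimmett's Theorem (2.43) for `φ^B_{G,p,q}` and the Lipschitz bound -/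

section RandomCluster

variable {V : Type*} [Fintype V] [DecidableEq V] (G : SimpleGraph V) [DecidableRel G.Adj]

/-- The tree's expectation `rcExpect G p q B X = Σ_ω (w(ω)/Z) X(ω)` is the weighted average `(Σ_ω w(ω) X(ω)) / Z`
of the tilted family with `a(ω) = |ω|`, `b(ω) = |E ∖ ω|`, `μ(ω) = q^{k^B(ω)}` (an identity of functions of `p`,
junk values included). [cite: Grimmett2006, §1.2 eq. (1.2)] -/
theorem rcExpect_eq_sum_mul_div (p q : ℝ) (B : Set V) (X : Finset (Sym2 V) → ℝ) :
    rcExpect G p q B X =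
      (∑ ω ∈ G.edgeFinset.powerset, p ^ #ω * (1 - p) ^ #(G.edgeFinset \ ω) *
          q ^ clusterCount (↑ω : BondConfig V) B * X ω) /
        ∑ ω ∈ G.edgeFinset.powerset, p ^ #ω * (1 - p) ^ #(G.edgeFinset \ ω) *
          q ^ clusterCount (↑ω : BondConfig V) B := by
  rw [rcExpect, Finset.sum_div]
  refine Finset.sum_congr rfl fun ω _ => ?_
  rw [rcPartitionFunction, div_mul_eq_mul_div]
  rfl

/-- **Grimmett's Theorem (2.43) for the random-cluster measure** (eq. (2.44) with `μ(ω) = q^{k^B(ω)}`): for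
`p ∈ (0, 1)`, `q > 0`, any wired set `B` and any `X`,
`d/dp E^B_{G,p,q}[X] = cov^B_{G,p,q}(|η|, X) / (p(1-p)) = (E[|ω| X] - E|ω| · E[X]) / (p(1-p))`.
[cite: Grimmett2006, Thm. (2.43) eq. (2.44) p. 40] -/
theorem hasDerivAt_rcExpect {q : ℝ} (hq : 0 < q) (B : Set V) (X : Finset (Sym2 V) → ℝ) {p : ℝ}
    (hp : p ∈ Set.Ioo (0 : ℝ) 1) :
    HasDerivAt (fun r => rcExpect G r q B X)
      ((rcExpect G p q B (fun ω => (#ω : ℝ) * X ω) -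
          rcExpect G p q B (fun ω => (#ω : ℝ)) * rcExpect G p q B X) / (p * (1 - p))) p := by
  have hp0 : p ≠ 0 := hp.1.ne'
  have hp1 : (1 : ℝ) - p ≠ 0 := (sub_pos.2 hp.2).ne'
  have hpI : p ∈ Set.Icc (0 : ℝ) 1 := ⟨hp.1.le, hp.2.le⟩
  set s := G.edgeFinset.powerset with hs
  set w : ℝ → Finset (Sym2 V) → ℝ := fun r ω =>
    r ^ #ω * (1 - r) ^ #(G.edgeFinset \ ω) * q ^ clusterCount (↑ω : BondConfig V) B with hw
  have hZ : ∑ ω ∈ s, w p ω ≠ 0 := (rcPartitionFunction_pos G hpI hq B).ne'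
  -- the derivative in covariance form, with the logarithmic derivative `ℓ = |ω|/p - |E∖ω|/(1-p)`
  have hD := hasDerivAt_sum_mul_div_sum s (w := w)
    (ℓ := fun ω => (#ω : ℝ) / p - (#(G.edgeFinset \ ω) : ℝ) / (1 - p)) X
    (fun ω _ => hasDerivAt_pow_mul_one_sub_pow_mul #ω #(G.edgeFinset \ ω) _ hp0 hp.2.ne) hZ
  have hfun : (fun r => rcExpect G r q B X) = fun r => (∑ ω ∈ s, w r ω * X ω) / ∑ ω ∈ s, w r ω := by
    funext r; exact rcExpect_eq_sum_mul_div G r q B X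
  rw [hfun]
  refine hD.congr_deriv ?_
  -- `ℓ = |ω| / (p(1-p)) - |E| / (1-p)` on edge sets `ω ⊆ E`: an affine function of `|ω|`
  rw [cov_eq_mul_cov_of_affine s (ℓ := fun ω => (#ω : ℝ)) X (c₁ := 1 / (p * (1 - p)))
    (c₂ := -((#G.edgeFinset : ℝ) / (1 - p))) hZ ?_]
  · rw [rcExpect_eq_sum_mul_div, rcExpect_eq_sum_mul_div, rcExpect_eq_sum_mul_div]
    simp only [hw, hs, mul_assoc]
    ring
  · intro ω hω
    rw [Finset.card_sdiff_of_subset (Finset.mem_powerset.1 hω),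
      Nat.cast_sub (Finset.card_le_card (Finset.mem_powerset.1 hω))]
    field_simp
    ring

/-- **Eq. (2.44) for events**: for `p ∈ (0, 1)`, `q > 0`, any wired set `B` and any event `A`,
`d/dp φ^B_{G,p,q}(A) = cov^B_{G,p,q}(|η|, 1_A) / (p(1-p))`.  (The measure-valued map `p ↦ φ^B_{G,p,q}` carries
junk values off `[0, 1]`; the derivative is taken at an interior point, where it agrees with the rational function
`rcExpect` of the indicator.) [cite: Grimmett2006, Thm. (2.43) eq. (2.44) p. 40] -/
theorem hasDerivAt_rcMeasure_real {q : ℝ} (hq : 0 < q) (B : Set V) (A : Set (BondConfig V))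
    [DecidablePred (· ∈ A)] {p : ℝ} (hp : p ∈ Set.Ioo (0 : ℝ) 1) :
    HasDerivAt (fun r => (rcMeasure G r q B).real A)
      ((rcExpect G p q B (fun ω => (#ω : ℝ) * if (↑ω : BondConfig V) ∈ A then 1 else 0) -
          rcExpect G p q B (fun ω => (#ω : ℝ)) * (rcMeasure G p q B).real A) / (p * (1 - p))) p := by
  have hpI : p ∈ Set.Icc (0 : ℝ) 1 := ⟨hp.1.le, hp.2.le⟩
  have hD := hasDerivAt_rcExpect G hq B (fun ω => if (↑ω : BondConfig V) ∈ A then (1 : ℝ) else 0) hp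
  rw [rcMeasure_real_eq_rcExpect G hpI hq B A]
  refine hD.congr_of_eventuallyEq ?_
  filter_upwards [Ioo_mem_nhds hp.1 hp.2] with r hr
  exact rcMeasure_real_eq_rcExpect G ⟨hr.1.le, hr.2.le⟩ hq B A

/-- **Boundary-condition-uniform Lipschitz continuity in `p` of finite-volume random-cluster probabilities**
(consequence of Grimmett 2006, Thm. (2.43): `|d/dp φ^B_{G,p,q}(A)| = |cov(|η|, 1_A)| / (p(1-p)) ≤ |E(G)| / (p(1-p))`).
For `q > 0`, ANY wired set `B`, ANY event `A` and `p, p' ∈ (0, 1)`: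
`|φ^B_{G,p',q}(A) - φ^B_{G,p,q}(A)| ≤ |E(G)| / min{p(1-p), p'(1-p')} · |p' - p|`.
[cite: Grimmett2006, Thm. (2.43) eq. (2.44) p. 40] -/
theorem abs_rcMeasure_real_sub_le {q : ℝ} (hq : 0 < q) (B : Set V) (A : Set (BondConfig V)) {p p' : ℝ}
    (hp : p ∈ Set.Ioo (0 : ℝ) 1) (hp' : p' ∈ Set.Ioo (0 : ℝ) 1) :
    |(rcMeasure G p' q B).real A - (rcMeasure G p q B).real A| ≤
      #G.edgeFinset / min (p * (1 - p)) (p' * (1 - p')) * |p' - p| := by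
  classical
  rw [rcMeasure_real_eq_rcExpect G ⟨hp'.1.le, hp'.2.le⟩ hq B A, rcMeasure_real_eq_rcExpect G ⟨hp.1.le, hp.2.le⟩ hq B A,
    rcExpect_eq_sum_mul_div, rcExpect_eq_sum_mul_div]
  refine abs_tiltAvg_sub_tiltAvg_le G.edgeFinset.powerset (a := fun ω => #ω) (b := fun ω => #(G.edgeFinset \ ω))
    (μ := fun ω => q ^ clusterCount (↑ω : BondConfig V) B) (N := #G.edgeFinset) _
    (fun ω hω => Finset.card_le_card (Finset.mem_powerset.1 hω)) (fun ω _ => Finset.card_le_card sdiff_subset)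
    (fun ω _ => pow_nonneg hq.le _) ⟨∅, Finset.empty_mem_powerset _, pow_pos hq _⟩ (fun ω _ => ?_) hp hp'
  split_ifs <;> norm_num

/-- The same bound with a constant depending only on a margin `δ`: for `p, p' ∈ [δ, 1-δ]`, `0 < δ`,
`|φ^B_{G,p',q}(A) - φ^B_{G,p,q}(A)| ≤ |E(G)| / (δ(1-δ)) · |p' - p|`, uniformly in `B`, `q > 0` and `A` — the form
used to perturb `p` simultaneously in every step of an exploration whose fresh regions have boundedly many edges.
[cite: Grimmett2006, Thm. (2.43) eq. (2.44) p. 40] -/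
theorem abs_rcMeasure_real_sub_le_of_mem_Icc {q : ℝ} (hq : 0 < q) (B : Set V) (A : Set (BondConfig V))
    {δ p p' : ℝ} (hδ : 0 < δ) (hp : p ∈ Set.Icc δ (1 - δ)) (hp' : p' ∈ Set.Icc δ (1 - δ)) :
    |(rcMeasure G p' q B).real A - (rcMeasure G p q B).real A| ≤ #G.edgeFinset / (δ * (1 - δ)) * |p' - p| := by
  have hδ1 : δ < 1 := by linarith [hp.1.trans hp.2]
  have hpo : p ∈ Set.Ioo (0 : ℝ) 1 := ⟨hδ.trans_le hp.1, by linarith [hp.2]⟩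
  have hpo' : p' ∈ Set.Ioo (0 : ℝ) 1 := ⟨hδ.trans_le hp'.1, by linarith [hp'.2]⟩
  refine (abs_rcMeasure_real_sub_le G hq B A hpo hpo').trans (mul_le_mul_of_nonneg_right ?_ (abs_nonneg _))
  have hmin : δ * (1 - δ) ≤ min (p * (1 - p)) (p' * (1 - p')) :=
    le_min (by nlinarith [hp.1, hp.2]) (by nlinarith [hp'.1, hp'.2])
  exact div_le_div_of_nonneg_left (Nat.cast_nonneg _) (mul_pos hδ (by linarith)) hmin

end RandomCluster

end FK

end Summit.CriticalPhenomena.PercolationContinuityZ3.Theorems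

end
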